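import Literature.AlgebraicGeometry.Frobenioids.EquivalenceUnitsDivSlim
import Literature.AlgebraicGeometry.Frobenioids.BirationalizationCategoryTheoreticity
import HarnessLib

/-!
# Frobenioids I, Corollary 4.11 (ii), the step "`Ψ^birat` preserves `O^×(−)`" (sub-node L11 of
# abc-iut-L1-d6's lemma list for [FrdI] Cor. 4.11)

Mochizuki, *The geometry of Frobenioids I: the general theory*, Kyushu J. Math. **62** (2008)
293–400, proof of Cor. 4.11 (ii), kurims text p. 93 ll. 36–46 [cite: MochizukiFrdI2008, Cor. 4.11 (ii) p.93]:

> "Thus, since `D_i` is Div-slim, the base-identity endomorphisms of `A ∈ Ob(C_i^birat)` may be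
> characterized as the endomorphisms of `A` that arise from endomorphisms
> `φ ∈ End((C_i^birat)^{pl-bk}_A → C_i^birat)` such that every endomorphism [of an object of `C_i^birat`]
> induced by `φ` projects to an automorphism of `D_i` that is mapped by `Φ_i` to an identity
> automorphism. Since, by Theorem 4.2, (ii) [cf. also the fact that the `Φ_i` are perf-factorial and
> non-dilating] … `Ψ^birat` preserves [these] …"

PROOF-ONLY file (seat abc-iut-L1-d4 gen 2; PIECE L11 assigned by the holder abc-iut-L1-d6, INBOX
2026-08-25T23:00:31Z). The argument is abc-iut-L1-t10's `EquivalenceUnitsDivSlim.lean` (Cor. 4.11 (i),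
p410020) RE-RUN RELATIVE TO A SECOND MONOID: the structure functor is that of the birationalization
`C^birat → F_{0_D}` (abc-iut-L1-L6-t8's `Birat.toElemZero`, over the ZERO monoid — so Div-identity and
Div-slimness measured through it would be vacuous resp. slimness), while "mapped by `Φ_i` to an identity"
and "`D_i` is Div-slim" are measured through the ORIGINAL divisor monoid `Φ_i` on the same base `D_i`:

* `base_app_eq_id_of_forall_pull_eq` — the relative Div-slim characterization: for a structure functor
  `G` whose pull-back slices are equivalent to base slices (Def. 1.3 (i)(c)) and a monoid `Φ'` on the base
  for which `D` is Div-slim, a natural automorphism of `(C^pl-bk)_B → C` all of whose components project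
  to `Φ'`-identity automorphisms of `D` has base-identity components;
* `mapIso_mem_unitsSubgroup_of_pull_eq` — the transport: an equivalence `Ψ` whose quasi-inverse
  preserves pull-back morphisms and which carries `Φ₁`-identity endomorphisms to `Φ₂`-identity
  endomorphisms preserves `O^×(−)`;
* `Birat.mapIso_mem_unitsSubgroup_mapOfEquiv` — **L11**: `Ψ^birat = mapOfEquiv …` preserves `O^×(−)`,
  with the printed inputs as NAMED HYPOTHESES: Def. 1.3 (i)(c) for `C₂^birat` ([FrdI] Prop. 4.4 (ii):
  `C^birat` is a Frobenioid), `Ψ^birat`'s quasi-inverse preserves pull-back morphisms (L10: base-isos,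
  hence pull-backs, Prop. 1.7 (ii)), `Ψ^birat` carries `Φ₁`-identity endomorphisms to `Φ₂`-identity
  endomorphisms (Thm. 4.2 (ii) with perf-factorial / non-dilating `Φ_i`), `D₂` Div-slim for `Φ₂`.
Nothing of [FrdI] is restated; the conclusion is exactly the holder's target.
-/

namespace Literature.AlgebraicGeometry.Frobenioids

open CategoryTheory Opposite

universe w w' v v' u u'

namespace PreFrobenioid

section Relative

variable {D : Type u} [Category.{v} D] {Θ : Dᵒᵖ ⥤ CommMonCat.{w}} {Φ' : Dᵒᵖ ⥤ CommMonCat.{w'}}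
  {C : Type u'} [Category.{v'} C] {G : C ⥤ ElemFrobenioid Θ}

/-- A base-identity endomorphism projects to a `Φ'`-identity automorphism of the base, for ANY monoid
`Φ'` on the base. [cite: MochizukiFrdI2008, Def. 1.2 (ii) p.22] -/
theorem pull_base_eq_id_of_isBaseIdentity {A : C} {φ : A ⟶ A} (h : IsBaseIdentity G φ) :
    pull Φ' (Base G φ) = MonoidHom.id _ := by
  unfold IsBaseIdentity at h
  rw [h]
  exact MonoidHom.ext fun x => pull_id Φ' _ x

/-- Conjugating by an isomorphism preserves "projects to a `Φ'`-identity automorphism".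
[cite: MochizukiFrdI2008, Def. 1.2 (ii) p.22] -/
theorem pull_base_conj_iso {A B : C} {φ : A ⟶ A} (h : pull Φ' (Base G φ) = MonoidHom.id _) (e : A ≅ B) :
    pull Φ' (Base G (e.inv ≫ φ ≫ e.hom)) = MonoidHom.id _ := by
  refine MonoidHom.ext fun x => ?_
  rw [base_comp, base_comp, pull_comp, pull_comp, MonoidHom.id_apply]
  have h' : pull Φ' (Base G φ) (pull Φ' (Base G e.hom) x) = pull Φ' (Base G e.hom) x := by
    rw [h, MonoidHom.id_apply]
  rw [h', ← pull_comp, ← base_comp, e.inv_hom_id, base_id, pull_id]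

/-- **The relative Div-slim characterization** (FrdI p. 93 ll. 36–42, the `C^birat`-version of the
argument of Cor. 4.11 (i) p. 92–93): let `G : C → F_Θ` be a pre-Frobenioid structure whose pull-back
slices `(C^pl-bk)_B` are equivalent to the base slices `D_{B_D}` (Def. 1.3 (i)(c), hypothesis `hic`) and
`Φ'` a monoid on the same base `D` for which `D` is Div-slim (`hds`, Def. 4.5 (iv)); then a natural
automorphism of `(C^pl-bk)_B → C` all of whose components project to `Φ'`-identity automorphisms of
`D` has BASE-IDENTITY components. [cite: MochizukiFrdI2008, Cor. 4.11 (ii) p.93] -/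
theorem base_app_eq_id_of_forall_pull_eq (hic : ∀ B : C, (pullbackSliceToBase G B).IsEquivalence)
    (hds : ∀ (X : D) (α : Aut (Over.forget X)),
      (∀ (V : Over X) (x : Φ'.obj (op V.left)), pull Φ' (α.hom.app V) x = x) → α = 1)
    {B : C}
    (ν : Over.forget (⟨B⟩ : PullbackCat G) ⋙ wideSubcategoryInclusion (pullbackMorphisms G) ≅
      Over.forget (⟨B⟩ : PullbackCat G) ⋙ wideSubcategoryInclusion (pullbackMorphisms G))
    (hν : ∀ W, pull Φ' (Base G (ν.hom.app W)) = MonoidHom.id _) (W : Over (⟨B⟩ : PullbackCat G)) :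
    Base G (ν.hom.app W) = 𝟙 _ := by
  let T := pullbackSliceToBase G B
  haveI : T.IsEquivalence := hic B
  let X₀ : D := (wideSubcategoryInclusion (pullbackMorphisms G) ⋙ baseFunctor G).obj ⟨B⟩
  let Fo : Over X₀ ⥤ D := Over.forget X₀
  let β : T ⋙ Fo ≅ T ⋙ Fo := NatIso.ofComponents
    (fun W => (baseFunctor G).mapIso (ν.app W)) (by
      intro W W' m
      exact (Functor.isoWhiskerRight ν (baseFunctor G)).hom.naturality m)
  let e : Over (⟨B⟩ : PullbackCat G) ≌ Over X₀ := T.asEquivalence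
  let Wh : (Over X₀ ⥤ D) ⥤ (Over (⟨B⟩ : PullbackCat G) ⥤ D) := (e.congrLeft (E := D)).inverse
  let hWh : Wh.FullyFaithful := (e.congrLeft (E := D)).fullyFaithfulInverse
  let γ : Fo ≅ Fo := hWh.preimageIso β
  have hγβ : Wh.mapIso γ = β := hWh.isoEquiv.apply_symm_apply β
  have hγT : ∀ W : Over (⟨B⟩ : PullbackCat G), γ.hom.app (T.obj W) = β.hom.app W := fun W => by
    have := congrArg (fun i : T ⋙ Fo ≅ T ⋙ Fo => i.hom.app W) hγβ
    exact this.symm ▸ rfl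
  have hγtriv : ∀ (V : Over X₀) (x : Φ'.obj (op V.left)), pull Φ' (γ.hom.app V) x = x := by
    intro V x
    let W := T.objPreimage V
    let i : T.obj W ≅ V := T.objObjPreimageIso V
    have hnat : γ.hom.app V = Fo.map i.inv ≫ γ.hom.app (T.obj W) ≫ Fo.map i.hom := by
      have h := γ.hom.naturality i.hom
      rw [← h, ← Category.assoc, ← Fo.map_comp, i.inv_hom_id, Fo.map_id, Category.id_comp]
    have hW : pull Φ' (γ.hom.app (T.obj W)) = MonoidHom.id _ := by
      rw [hγT W]
      exact hν W
    rw [hnat, pull_comp, pull_comp, hW, MonoidHom.id_apply, ← pull_comp, ← Fo.map_comp,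
      i.inv_hom_id, Fo.map_id, pull_id]
  have hγ1 : γ = Iso.refl Fo := hds X₀ γ hγtriv
  have hβ1 : β.hom.app W = 𝟙 _ := by
    rw [← hγT W, hγ1]
    rfl
  exact hβ1

end Relative

section TwoRelative

variable {D₁ : Type u} [Category.{v} D₁] {Θ₁ : D₁ᵒᵖ ⥤ CommMonCat.{w}} {Φ₁ : D₁ᵒᵖ ⥤ CommMonCat.{w'}}
  {C₁ : Type u'} [Category.{v'} C₁]
  {D₂ : Type u} [Category.{v} D₂] {Θ₂ : D₂ᵒᵖ ⥤ CommMonCat.{w}} {Φ₂ : D₂ᵒᵖ ⥤ CommMonCat.{w'}}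
  {C₂ : Type u'} [Category.{v'} C₂]

/-- **Transport of `O^×(−)` along an equivalence, relative version** (FrdI proof of Cor. 4.11 (ii), p. 93,
modelled on abc-iut-L1-t10's `mapIso_mem_unitsSubgroup_of_isDivSlim` for (i)): structure functors
`Gᵢ : Cᵢ → F_{Θᵢ}` (in the application: `Cᵢ^birat → F_{0_{Dᵢ}}`), second monoids `Φᵢ` on the bases
(in the application: the divisor monoids of `Cᵢ`), an equivalence `Ψ : C₁ ⥲ C₂` whose quasi-inverse
carries pull-back morphisms to pull-back morphisms (`hpb'`) and which carries endomorphisms projecting to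
`Φ₁`-identities to endomorphisms projecting to `Φ₂`-identities (`hdi`), pull-back slices of `G₂`
equivalent to base slices (`hic₂`), `D₂` Div-slim for `Φ₂` (`hds₂`): then `f ∈ O^×(A) ⇒ Ψ(f) ∈ O^×(Ψ A)`.
[cite: MochizukiFrdI2008, Cor. 4.11 (ii) p.93] -/
theorem mapIso_mem_unitsSubgroup_of_pull_eq (G₁ : C₁ ⥤ ElemFrobenioid Θ₁) (G₂ : C₂ ⥤ ElemFrobenioid Θ₂)
    (Ψ : C₁ ≌ C₂) (hic₂ : ∀ B : C₂, (pullbackSliceToBase G₂ B).IsEquivalence)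
    (hds₂ : ∀ (X : D₂) (α : Aut (Over.forget X)),
      (∀ (V : Over X) (x : Φ₂.obj (op V.left)), pull Φ₂ (α.hom.app V) x = x) → α = 1)
    (hpb' : ∀ {Y Z : C₂} (δ : Y ⟶ Z), IsPullbackMorphism G₂ δ → IsPullbackMorphism G₁ (Ψ.inverse.map δ))
    (hdi : ∀ (A : C₁) (φ : A ⟶ A), pull Φ₁ (Base G₁ φ) = MonoidHom.id _ →
      pull Φ₂ (Base G₂ (Ψ.functor.map φ)) = MonoidHom.id _)
    {A : C₁} (f : Aut A) (hf : f ∈ unitsSubgroup G₁ A) :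
    Ψ.functor.mapIso f ∈ unitsSubgroup G₂ (Ψ.functor.obj A) := by
  obtain ⟨f, rfl⟩ : ∃ g : A ≅ A, g = f := ⟨f, rfl⟩
  have hfb : IsBaseIdentity G₁ f.hom := (show IsBaseIdentity G₁ f.hom ∧ IsLinear G₁ f.hom from hf).1
  have hft : IsBaseIdentity G₁ (Ψ.inverse.mapIso (Ψ.functor.mapIso f)).hom := by
    have h := hfb.conj_iso (Ψ.unitIso.app A)
    have e : (Ψ.inverse.mapIso (Ψ.functor.mapIso f)).hom =
        (Ψ.unitIso.app A).inv ≫ f.hom ≫ (Ψ.unitIso.app A).hom := Ψ.inv_fun_map _ _ f.hom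
    unfold IsBaseIdentity at h ⊢
    rw [e]
    exact h
  obtain ⟨ν₁, hν₁b, hν₁c⟩ := exists_natIso_of_isBaseIdentity (Ψ.inverse.mapIso (Ψ.functor.mapIso f)) hft
  let toW₁ : Over (⟨Ψ.functor.obj A⟩ : PullbackCat G₂) →
      Over (⟨Ψ.inverse.obj (Ψ.functor.obj A)⟩ : PullbackCat G₁) := fun W =>
    Over.mk (⟨Ψ.inverse.map W.hom.hom, hpb' W.hom.hom W.hom.property⟩ :
      (⟨Ψ.inverse.obj W.left.obj⟩ : PullbackCat G₁) ⟶ (⟨Ψ.inverse.obj (Ψ.functor.obj A)⟩ : PullbackCat G₁))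
  have hnIty : ∀ W : Over (⟨Ψ.functor.obj A⟩ : PullbackCat G₂),
      ∃ e : Ψ.inverse.obj W.left.obj ≅ Ψ.inverse.obj W.left.obj, e = ν₁.app (toW₁ W) :=
    fun W => ⟨_, rfl⟩
  choose nI hnI using hnIty
  have hnIhom : ∀ W, (nI W).hom = ν₁.hom.app (toW₁ W) := fun W => by rw [hnI W]; rfl
  have hεty : ∀ Y : C₂, ∃ e : Ψ.functor.obj (Ψ.inverse.obj Y) ≅ Y, e = Ψ.counitIso.app Y :=
    fun Y => ⟨_, rfl⟩
  choose ε hε₀ using hεty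
  have hε : ∀ {Y Y' : C₂} (g : Y ⟶ Y'), g ≫ (ε Y').inv = (ε Y).inv ≫ Ψ.functor.map (Ψ.inverse.map g) := by
    intro Y Y' g
    rw [hε₀ Y, hε₀ Y']
    have := Ψ.counitIso.inv.naturality g
    dsimp at this
    exact this
  have hε' : ∀ {Y Y' : C₂} (g : Y ⟶ Y'),
      Ψ.functor.map (Ψ.inverse.map g) ≫ (ε Y').hom = (ε Y).hom ≫ g := by
    intro Y Y' g
    rw [hε₀ Y, hε₀ Y']
    have := Ψ.counitIso.hom.naturality g
    dsimp at this
    exact this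
  let c : ∀ W : Over (⟨Ψ.functor.obj A⟩ : PullbackCat G₂), W.left.obj ≅ W.left.obj := fun W =>
    (ε W.left.obj).symm ≪≫ Ψ.functor.mapIso (nI W) ≪≫ ε W.left.obj
  have hc : ∀ W, (c W).hom = (ε W.left.obj).inv ≫ Ψ.functor.map (nI W).hom ≫ (ε W.left.obj).hom :=
    fun W => rfl
  let ν₂ : Over.forget (⟨Ψ.functor.obj A⟩ : PullbackCat G₂) ⋙ wideSubcategoryInclusion (pullbackMorphisms G₂) ≅
      Over.forget (⟨Ψ.functor.obj A⟩ : PullbackCat G₂) ⋙ wideSubcategoryInclusion (pullbackMorphisms G₂) :=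
    NatIso.ofComponents c (by
      intro W W' m
      have hmty : ∃ mh : W.left.obj ⟶ W'.left.obj, mh = m.left.hom := ⟨_, rfl⟩
      obtain ⟨mh, hmh⟩ := hmty
      change m.left.hom ≫ (c W').hom = (c W).hom ≫ m.left.hom
      rw [← hmh, hc W, hc W']
      have hm : mh ≫ W'.hom.hom = W.hom.hom := by
        rw [hmh]
        exact congrArg InducedWideCategory.Hom.hom (Over.w m)
      have hmpb : IsPullbackMorphism G₂ mh := by
        rw [hmh]
        exact m.left.property
      let m₁ : toW₁ W ⟶ toW₁ W' := Over.homMk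
        (⟨Ψ.inverse.map mh, hpb' mh hmpb⟩ :
          (⟨Ψ.inverse.obj W.left.obj⟩ : PullbackCat G₁) ⟶ ⟨Ψ.inverse.obj W'.left.obj⟩) (by
          apply InducedWideCategory.Hom.ext
          change Ψ.inverse.map mh ≫ Ψ.inverse.map W'.hom.hom = Ψ.inverse.map W.hom.hom
          rw [← Functor.map_comp, hm])
      have key : Ψ.inverse.map mh ≫ (nI W').hom = (nI W).hom ≫ Ψ.inverse.map mh := by
        rw [hnIhom W, hnIhom W']
        exact ν₁.hom.naturality m₁
      have key' : Ψ.functor.map (Ψ.inverse.map mh) ≫ Ψ.functor.map (nI W').hom =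
          Ψ.functor.map (nI W).hom ≫ Ψ.functor.map (Ψ.inverse.map mh) := by
        rw [← Functor.map_comp, key, Functor.map_comp]
      rw [← Category.assoc, hε mh, Category.assoc, ← Category.assoc (Ψ.functor.map _), key',
        Category.assoc, hε' mh]
      simp only [Category.assoc])
  have hν₂app : ∀ W, ν₂.hom.app W = (c W).hom := fun W => rfl
  -- the components of `ν₂` project to `Φ₂`-identity automorphisms of `D₂`
  have hν₂ : ∀ W, pull Φ₂ (Base G₂ (ν₂.hom.app W)) = MonoidHom.id _ := by
    intro W
    rw [hν₂app W, hc W]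
    have h1 : pull Φ₁ (Base G₁ (nI W).hom) = MonoidHom.id _ := by
      rw [hnIhom W]
      exact pull_base_eq_id_of_isBaseIdentity (hν₁b (toW₁ W))
    exact pull_base_conj_iso (hdi _ _ h1) (ε W.left.obj)
  let W₀ : Over (⟨Ψ.functor.obj A⟩ : PullbackCat G₂) := Over.mk (𝟙 (⟨Ψ.functor.obj A⟩ : PullbackCat G₂))
  have hbase : Base G₂ (ν₂.hom.app W₀) = 𝟙 _ := base_app_eq_id_of_forall_pull_eq hic₂ hds₂ ν₂ hν₂ W₀
  set n₀ : Ψ.inverse.obj (Ψ.functor.obj A) ⟶ Ψ.inverse.obj (Ψ.functor.obj A) := (nI W₀).hom with hn₀def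
  have hn₀ : n₀ = Ψ.inverse.map (Ψ.functor.map f.hom) := by
    have h : n₀ ≫ Ψ.inverse.map (𝟙 (Ψ.functor.obj A)) =
        Ψ.inverse.map (𝟙 (Ψ.functor.obj A)) ≫ Ψ.inverse.map (Ψ.functor.map f.hom) := by
      have h0 := hν₁c (toW₁ W₀)
      rw [← hnIhom W₀] at h0
      exact h0
    rwa [CategoryTheory.Functor.map_id, Category.comp_id, Category.id_comp] at h
  have hW₀ : ν₂.hom.app W₀ = Ψ.functor.map f.hom := by
    change (ε (Ψ.functor.obj A)).inv ≫ Ψ.functor.map n₀ ≫ (ε (Ψ.functor.obj A)).hom = Ψ.functor.map f.hom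
    rw [hn₀, hε' (Ψ.functor.map f.hom), ← Category.assoc, (ε (Ψ.functor.obj A)).inv_hom_id,
      Category.id_comp]
  rw [hW₀] at hbase
  exact ⟨hbase, degFr_iso_hom G₂ (Ψ.functor.mapIso f)⟩

end TwoRelative

/-! ### L11: `Ψ^birat` preserves `O^×(−)` -/

namespace Birat

variable {D₁ : Type u} [Category.{v} D₁] {Φ₁ : D₁ᵒᵖ ⥤ CommMonCat.{w}}
  {C₁ : Type u'} [Category.{v'} C₁] {F₁ : C₁ ⥤ ElemFrobenioid Φ₁}
  {D₂ : Type u} [Category.{v} D₂] {Φ₂ : D₂ᵒᵖ ⥤ CommMonCat.{w}}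
  {C₂ : Type u'} [Category.{v'} C₂] {F₂ : C₂ ⥤ ElemFrobenioid Φ₂}

/-- **[FrdI] Cor. 4.11 (ii), "`Ψ^birat` preserves `O^×(−)`"** (sub-node L11; p. 93 ll. 36–46): for an
equivalence `Ψ : C₁ ⥲ C₂` of Frobenioids with its induced `Ψ^birat = mapOfEquiv …` (Cor. 4.10), a
base-identity automorphism `u ∈ O^×(X)` of an object `X` of `C₁^birat` is carried to
`Ψ^birat(u) ∈ O^×(Ψ^birat X)`. Printed inputs as NAMED HYPOTHESES (none restated here): `hΨ`/`hΨ'` —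
`Ψ`, `Ψ⁻¹` carry co-angular pre-steps to co-angular pre-steps (Thm. 3.4 (ii); discharged over FSM-type bases
by abc-iut-L1-t13) so that `Ψ^birat` is an equivalence; `hic₂` — Def. 1.3 (i)(c) for `C₂^birat → F_{0_{D₂}}`
(Prop. 4.4 (ii): `C^birat` is a Frobenioid); `hpb'` — the quasi-inverse of `Ψ^birat` carries pull-back
morphisms of `C₂^birat` to pull-back morphisms of `C₁^birat` (sub-node L10: base-isomorphisms, hence
pull-backs by Prop. 1.7 (ii)); `h42ii` — `Ψ^birat` carries endomorphisms projecting to `Φ₁`-identity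
automorphisms of `D₁` to endomorphisms projecting to `Φ₂`-identity automorphisms of `D₂` (Thm. 4.2 (ii),
with `Φ_i` perf-factorial and non-dilating); `hds₂` — `D₂` is Div-slim (Def. 4.5 (iv), abc-iut-L1-t3's
`IsDivSlim`). [cite: MochizukiFrdI2008, Cor. 4.11 (ii) p.93] -/
theorem mapIso_mem_unitsSubgroup_mapOfEquiv (hF₁ : IsFrobenioid F₁) (hsq₁ : HasBiratSquares F₁)
    (hF₂ : IsFrobenioid F₂) (hsq₂ : HasBiratSquares F₂) (Ψ : C₁ ≌ C₂)
    (hΨ : ∀ ⦃A B : C₁⦄ (f : A ⟶ B), IsCoAngularPreStep F₁ f → IsCoAngularPreStep F₂ (Ψ.functor.map f))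
    (hΨ' : ∀ ⦃A B : C₂⦄ (f : A ⟶ B), IsCoAngularPreStep F₂ f → IsCoAngularPreStep F₁ (Ψ.inverse.map f))
    (hic₂ : ∀ B : Birat F₂ hF₂ hsq₂, (pullbackSliceToBase (Birat.toElemZero hF₂ hsq₂) B).IsEquivalence)
    (hds₂ : (PreFrobenioidData.ofFunctor Φ₂ F₂).IsDivSlim)
    (hpb' : letI := mapOfEquiv_isEquivalence hF₁ hsq₁ hF₂ hsq₂ Ψ hΨ hΨ'
      ∀ {Y Z : Birat F₂ hF₂ hsq₂} (δ : Y ⟶ Z), IsPullbackMorphism (Birat.toElemZero hF₂ hsq₂) δ →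
        IsPullbackMorphism (Birat.toElemZero hF₁ hsq₁) ((mapOfEquiv hF₁ hsq₁ hF₂ hsq₂ Ψ hΨ).inv.map δ))
    (h42ii : ∀ (X : Birat F₁ hF₁ hsq₁) (φ : X ⟶ X),
      pull Φ₁ (Base (Birat.toElemZero hF₁ hsq₁) φ) = MonoidHom.id _ →
        pull Φ₂ (Base (Birat.toElemZero hF₂ hsq₂) ((mapOfEquiv hF₁ hsq₁ hF₂ hsq₂ Ψ hΨ).map φ)) =
          MonoidHom.id _)
    {X : Birat F₁ hF₁ hsq₁} (u : Aut X) (hu : u ∈ unitsSubgroup (Birat.toElemZero hF₁ hsq₁) X) :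
    (mapOfEquiv hF₁ hsq₁ hF₂ hsq₂ Ψ hΨ).mapIso u ∈
      unitsSubgroup (Birat.toElemZero hF₂ hsq₂) ((mapOfEquiv hF₁ hsq₁ hF₂ hsq₂ Ψ hΨ).obj X) := by
  letI := mapOfEquiv_isEquivalence hF₁ hsq₁ hF₂ hsq₂ Ψ hΨ hΨ'
  have hds' : ∀ (Y : D₂) (α : Aut (Over.forget Y)),
      (∀ (V : Over Y) (x : Φ₂.obj (op V.left)), pull Φ₂ (α.hom.app V) x = x) → α = 1 :=
    fun Y α h => hds₂.eq_one Y α fun V x => h V x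
  exact mapIso_mem_unitsSubgroup_of_pull_eq (Φ₁ := Φ₁) (Φ₂ := Φ₂) (Birat.toElemZero hF₁ hsq₁)
    (Birat.toElemZero hF₂ hsq₂) (mapOfEquiv hF₁ hsq₁ hF₂ hsq₂ Ψ hΨ).asEquivalence hic₂ hds'
    (fun δ hδ => hpb' δ hδ) h42ii u hu

end Birat

end PreFrobenioid

end Literature.AlgebraicGeometry.Frobenioids
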